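import Mathlib.NumberTheory.NumberField.Basic
import Literature.NumberTheory.DiophantineGeometry.AVIsogenyFlat
import HarnessLib

/-!
# The Masser–Wüstholz isogeny theorem (polarisation-free), qualitative form

Topic `NumberTheory/DiophantineGeometry`. A NAMED FACT (D-0014, `def … : Prop`, no `_holds`):

* `exists_isogeny_kerRank_le_of_isIsogenous A` — for an abelian variety `A` over a number field `K`
  there is `N` such that every abelian variety `B` over `K` admitting an isogeny `B → A` over `K`
  is the target of an isogeny `g : A → B` over `K` of degree `Hom.kerRank g ≤ N`.

## Source and what is vendored

Masser–Wüstholz, *Factorization estimates for abelian varieties*, Publ. Math. IHÉS 81 (1995),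
5–24, **Theorem II** (p. 6): "Given positive integers `n` and `d`, there is a constant `κ`
depending only on `n`, and there is a constant `C` depending only on `n` and `d`, with the following
property. Suppose `A` and `A*` are abelian varieties of dimension `n` defined over a number field
`k` of degree `d`. Let `K` be any field containing `k`. Then if they are isogenous over `K`, there is
an isogeny over `K` from `A` to `A*` of degree at most `C (max{1, h(A)})^κ`." Here `h(A)` is the
logarithmic absolute semistable Faltings height (loc. cit., §1) and the degree of an isogeny is the
order of its kernel. The theorem removes the dependence on polarisations of the earlier isogeny
estimates (Masser–Wüstholz, Ann. of Math. 137 (1993), 459–472 = Baker–Wüstholz, *Logarithmic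
Forms and Diophantine Geometry* (2007), Thm. 7.5, whose constant depends on the degrees of
polarisations on both varieties); the proof (loc. cit., §7) rests on the period theorem, Zarhin's
trick and a quantitative Jordan–Zassenhaus theorem. Explicit constants: Gaudron–Rémond,
*Polarisations et isogénies*, Duke Math. J. 163 (2014), Thm. 1.4.

Vendored is the **qualitative consequence in the rational case `K = k`**, the only form the tree
can state today: the bound `C (max{1, h(A)})^κ` is a function of `A` alone, so for fixed `A` there is
ONE integer `N` bounding the degree of a suitable isogeny `A → B` onto every `B` isogenous to `A`
over `k`. The explicit bound needs the stable Faltings height of an abelian variety of dimension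
`≥ 2`, which the tree does not have (`Literature/NumberTheory/DiophantineGeometry/FaltingsHeight`
defines it for elliptic curves only and otherwise offers the interface `FaltingsHeightTheory`); see
the `TODO(general form)` below.

## Typing

* `Literature.AlgebraicGeometry.Motives.AbelianVariety K` (proper, geometrically integral group
  scheme over `Spec K`); morphisms are homomorphisms of `K`-group schemes.
* "`B` isogenous to `A` over `K`": `AbelianVariety.IsIsogenous B A` (an isogeny — finite surjective
  homomorphism — `B → A` exists). For abelian varieties the relation is symmetric (Mumford §19;
  `AbelianVariety.IsIsogenous.symm_of_charZero`, proved in `AVIsogenySymmProofs`), so this is the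
  printed hypothesis "isogenous"; and `dim B = dim A` (`dim_eq_of_isIsogenous_holds`), the printed
  "of dimension `n`".
* "degree of `g`": `AbelianVariety.Hom.kerRank g = dim_K Γ(Ker g, 𝒪)`, the order of the finite
  kernel group scheme (`AVIsogenyFlat`; Görtz–Wedhorn II, Cor. 27.177), which over a field of
  characteristic `0` is the number of `K̄`-points of the kernel.
* `[NumberField K]` is quantified in the body, exactly as in the sibling fact
  `AbelianVariety.finite_isoClasses_isogenous` (`Motives/FaltingsFinitenessI`).

## Why this fact

It is the transcendence road to Faltings' **Finiteness I** (Baker–Wüstholz 2007, §7.4, p. 165: the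
isogeny theorem "enables one to show that an isogeny class contains only finitely many isomorphism
classes"): Finiteness I over any number field follows from this fact by counting geometric kernels
inside `A[N!](K̄)` — carried out sorry-free in
`Summits/Langlands/Langlands/Theorems/PhantomRMYoshidaFaltingsFinitenessIOfIsogenyBound.lean`
(`exists_isoClasses_of_isogeny_kerRank_le`, over any field of characteristic `0`). Conversely
Finiteness I implies this qualitative form (one isogeny per representative), so the two named facts
are equivalent in strength; this one is the form the effective (transcendence) method proves.
Only the `∃ g` form is true: the `∀ g` form is refuted by `[N+1] : E → E`
(`Summits/Langlands/Langlands/Theorems/FaltingsFinitenessI/Negative/NotIsogenyKernelBoundForall.lean`).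

## References

* [MasserWustholz1995] D. W. Masser, G. Wüstholz, *Factorization estimates for abelian varieties*,
  Publ. Math. IHÉS 81 (1995), 5–24, Theorem II (p. 6), §7 (proof) (held: lit key
  `paper:doi-10-1007-bf02699374`, pp. 5–7 and 21–23 read).
* [MasserWustholz1993] D. W. Masser, G. Wüstholz, *Isogeny estimates for abelian varieties, and
  finiteness theorems*, Ann. of Math. 137 (1993), 459–472 (polarised predecessor; not held).
* [GaudronRemond2014] É. Gaudron, G. Rémond, *Polarisations et isogénies*, Duke Math. J. 163
  (2014), 2057–2108, Thm. 1.4 (explicit constants; not held).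
* A. Baker, G. Wüstholz, *Logarithmic Forms and Diophantine Geometry* (2007), Thm. 7.5 and §7.4,
  p. 165 (held, read).

## Design choices

`noncomputable section`; universe-polymorphic `K : Type u` (as `AbelianVariety`); namespace =
directory (`Literature.NumberTheory.DiophantineGeometry`); unfolding lemma `_iff` by `Iff.rfl`.
Deliberately NOT here: the Faltings height, the explicit bound, the relative case `K ⊋ k`, and any
consequence needing other files (Finiteness I from this fact lives with its consumer).

## Discharge status and review (2026-08-16, review-split seat, source re-read)

* **Verdict: faithful and ESTABLISHED; terminal classification `xl-apex` — the fact stays a CITED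
  named fact, its statement unchanged by this review.** Re-read: Masser–Wüstholz 1995 (numdam copy
  of `paper:doi-10-1007-bf02699374`), Theorem II on journal p. 6 exactly as quoted above, and its
  proof, §7, journal pp. 21–23. The fact is the rational case `K = k` with the printed bound
  specialised to one integer per `A` (`n = dim A = dim B` for isogenous `A`, `B`; `d = [K:ℚ]`;
  `N = ⌊C(n,d) · max{1, h(A)}^κ⌋`); "isogenous" is symmetric in characteristic `0`
  (`IsIsogenous.symm_of_charZero`) and the printed degree is the order of the kernel
  (`Hom.kerRank`). Not an open problem, not misstated, weaker than printed (the `TODO` above).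
* **Why there is no `_holds` (size, not doubt).** The printed proof (§7) composes: the polarised
  isogeny estimate (7.1), "proved as the Corollary in [MW4]" (Masser–Wüstholz, *Endomorphism
  estimates for abelian varieties*, Math. Z. 215 (1994), 641–653, in the line of the Period Theorem
  of *Periods and minimal abelian subvarieties*, Ann. of Math. 137 (1993), 407–458); Zarhin's trick
  `Z(A) = (A × Â)⁴`, principally polarised (proof of Lemma 7.1, p. 21); Lemma 6.3 (an isogeny between
  `Â` and `A` of degree `≤ c · max{1, h(A)}^λ`, from the class-index and discriminant estimates of
  §§2–6 — a quantitative Jordan–Zassenhaus theorem, p. 7); the height comparisons (1.1)–(1.2); and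
  Theorem I (factorisation estimate), p. 22. Each ingredient is absent from Mathlib and from
  `Literature/`: the Faltings height of an abelian variety of dimension `≥ 2` (`FaltingsHeight`:
  elliptic curves only), the dual abelian variety and polarisations (deferred in
  `Motives/AbelianVariety`), transcendence on commutative group varieties, orders and discriminants
  of semisimple algebras over `ℚ`. A theory, not a session.
* **Relation to Faltings' Finiteness I (why this is not a smaller piece of anything).** Kernel-checked
  in the tree, for every `A` over a number field:
  `exists_isogeny_kerRank_le_of_isIsogenous A ↔ AbelianVariety.finite_isoClasses_isogenous A` —
  (⇐) `exists_isogeny_kerRank_le_of_isIsogenous_of_finite_isoClasses_isogenous`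
  (`MasserWustholzIsogenyOfFinitenessIProofs`: one isogeny per representative), (⇒) by counting
  geometric kernels inside `A[N!]` (summit side,
  `Summits/Langlands/Langlands/Theorems/PhantomRMYoshidaFaltingsFinitenessIOfMasserWustholz.lean`,
  `finite_isoClasses_isogenous_iff_exists_isogeny_kerRank_le`). The two named facts are thus ONE
  item of trust-base debt under two names, and `finite_isoClasses_isogenous` (Milne, *Abelian
  Varieties* IV Thm. 1.1; Faltings 1983, §6) is itself classified XL-apex (Néron models, heights on
  the moduli space, Tate–Raynaud, Hodge–Tate decompositions: absent). Exact residue of a discharge of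
  THIS fact: either `finite_isoClasses_isogenous_holds` — after which the discharge of this fact at
  `A` is the one-line term
  `exists_isogeny_kerRank_le_of_isIsogenous_of_finite_isoClasses_isogenous A (finite_isoClasses_isogenous_holds A)`
  — or the transcendence proof above.
* **Bookkeeping.** The fact was minted by the lead of line `Sketch` of crux stmt-Langlands-15084
  (Finiteness I over `ℚ`) as that line's kernel K1 (`stub_isogenyKernelBound` = this fact at
  `K = ℚ`): a published theorem wanted by a route, not a slice cut out of another fact's proof, so
  there is nothing to restate. Retiring it in favour of `finite_isoClasses_isogenous` alone is the
  line lead's call (its two summit-side consumers are `supports` files of that crux). Until either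
  residue above exists, proof seats on this declaration can only return the same verdict.
-/

noncomputable section

universe u

open CategoryTheory

namespace Literature.NumberTheory.DiophantineGeometry

open Literature.AlgebraicGeometry.Motives (AbelianVariety)
open Literature.AlgebraicGeometry.Motives.AbelianVariety

variable {K : Type u} [Field K] (A : AbelianVariety K)

/-- **The Masser–Wüstholz isogeny theorem, qualitative form** (Masser–Wüstholz, Publ. Math.
IHÉS 81 (1995), Theorem II, p. 6, rational case `K = k`: isogenous abelian varieties `A`, `A*` of
dimension `n` over a number field `k` of degree `d` are joined by an isogeny `A → A*` over `k` of
degree at most `C(n, d) · (max{1, h(A)})^{κ(n)}`). Since that bound depends on `A` alone: for an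
abelian variety `A` over a number field `K` there is `N : ℕ` such that every abelian variety `B`
over `K` admitting an isogeny `B → A` is the target of an isogeny `g : A → B` over `K` with
`Hom.kerRank g ≤ N` (the degree of `g` = the order of its kernel group scheme).
-- TODO(general form): `deg g ≤ C(dim A, [K:ℚ]) · max(1, h_F(A))^{κ(dim A)}` with the stable
-- Faltings height `h_F`, and isogenies over an arbitrary field containing `K` (loc. cit.), once
-- `h_F` of an abelian variety is defined in the tree.
[cite: MasserWustholz1995, Theorem II (p. 6)] -/
def exists_isogeny_kerRank_le_of_isIsogenous : Prop :=
  ∀ [NumberField K], ∃ N : ℕ, ∀ B : AbelianVariety K, IsIsogenous B A →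
    ∃ g : A ⟶ B, IsIsogeny g ∧ Hom.kerRank g ≤ N

/-- Unfolding lemma for `exists_isogeny_kerRank_le_of_isIsogenous` (`Iff.rfl`). [folklore] -/
theorem exists_isogeny_kerRank_le_of_isIsogenous_iff :
    exists_isogeny_kerRank_le_of_isIsogenous A ↔
      ∀ [NumberField K], ∃ N : ℕ, ∀ B : AbelianVariety K, IsIsogenous B A →
        ∃ g : A ⟶ B, IsIsogeny g ∧ Hom.kerRank g ≤ N :=
  Iff.rfl

end Literature.NumberTheory.DiophantineGeometry

end
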